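import Literature.AnabelianGeometry.SemiGraphs.TemperedSpecialFibreCor311Equivariance
import Literature.AnabelianGeometry.SemiGraphs.SemiGraphIsoTransport
import Literature.AnabelianGeometry.SemiGraphs.TieGraphIso
import HarnessLib

/-!
# [SemiAnbd] Cor. 3.11 «functorial with respect to `γ`» in the currency of semi-graph AUTOMORPHISMS:
# the reconstructed isomorphism as `𝔾^c[α] ≅ 𝔾^c[β]`, equivariant for actions `Γ → Aut 𝔾^c`

Mochizuki, *Semi-graphs of anabelioids*, Publ. RIMS **42** (2006), §3, Corollary 3.11, manuscript
pp. 45–46 («determines a compatible isomorphism of semi-graphs of anabelioids `𝒢^c[α] ⥲ 𝒢^c[β]` in a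
fashion that is functorial with respect to `γ`») [cite: MochizukiSemiAnbd2006, Cor 3.11 pp.45-46]; Example
3.10 p. 44 («semi-graphs of anabelioids `𝒢_i`, `𝒢^c_i` on which `Δ_i` acts») [cite: MochizukiSemiAnbd2006, Ex 3.10 p.44];
§6 Thm. 6.5 (iii) p. 72 l. 14 («follows from Corollary 3.11»).

PROOF-ONLY sequel (abc-iut cell, seat abc-iut-L3-d2 gen 6, row «COR311-EQUIVARIANCE⟸FUNCTORIALITY» (C); no
`def`, no instance, no new named fact) to `TemperedSpecialFibreCor311Equivariance.lean`:

* `ProfiniteSemiGraph.Hom.IsIso.isIso_base` — an isomorphism of semi-graphs of anabelioids in the sense of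
  `Cor311` (`Hom.IsIso`: bijective on vertices and edges, «abuts to no vertex» preserved, locally trivial)
  has an underlying morphism of semi-graphs that is an isomorphism IN THE CATEGORY `SemiGraph`
  (abc-iut-L3-t6's `SemiGraph.Hom.isoOfBijective`; branches are bijective once edges are,
  `branchMap_bijective_of_edgeMap_bijective`) — the bridge from F-1721's output to the transport files of
  abc-iut-L3-t3/d6, which assume `[IsIso F.base]`;
* `cor311_base_equivariant_of_autAction` — the `γ`-equivariance of the compatible isomorphism `F`
  (`cor311_base_equivariant`) against families of AUTOMORPHISMS `AX : Γ → Aut 𝔾^c[α]`,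
  `AY : Γ' → Aut 𝔾^c[β]` along `t : Γ → Γ'`, provided each `AX g` / `AY g'` underlies a Cor-3.11-compatible
  self-isomorphism over `σ g` / `τ g'` and `γ ∘ σ g = τ (t g) ∘ γ`;
* ★ `cor311_exists_graphIso_equivariant` — at certified special fibres and for every `γ`, F-1721 (BY NAME)
  yields `FI : 𝔾^c[α] ≅ 𝔾^c[β]` underlying a `γ`-compatible isomorphism with
  `FI.hom.edgeMap ((AX g).hom.edgeMap e) = (AY (t g)).hom.edgeMap (FI.hom.edgeMap e)` (and the same on
  vertices) — VERBATIM the shape of clause (3) of the binder `hLG` of abc-iut-L3-t11's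
  `TemperedCuspidalAbsolutenessOfProCusps.lean` (`FI i`, `AX i : Π →* Aut (T_X.Gc i).graph`, `g : Δ^temp_X`,
  `t = γ`), so that clause is supplied by F-1721 once (α) the level fibres are certified special-fibre data
  and (β′) the values of the (P2) actions `actGraph i` underlie Cor-3.11-compatible self-isomorphisms over
  the inner automorphisms (the β61 bank; interface laws of the abc-iut-L3-t2 / w4-d083 lineages).

`Cor311` stays a NAMED hypothesis (FACT-policy); nothing is asserted for any curve; nothing here takes a
side on [IUTchIII] Cor. 3.12; typed ≠ proved.
-/

noncomputable section

open CategoryTheory Topology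

namespace Literature.AnabelianGeometry.SemiGraphs

universe u

/-! ### `Hom.IsIso` gives an isomorphism of underlying semi-graphs in the category `SemiGraph` -/

namespace ProfiniteSemiGraph

variable {𝒢 ℋ : ProfiniteSemiGraph.{u}}

/-- The underlying morphism of semi-graphs of an isomorphism of semi-graphs of anabelioids (bijective
on vertices and edges, preserving «abuts to no vertex») is an isomorphism of the category of semi-graphs
— bijective on branches by `branchMap_bijective_of_edgeMap_bijective`, inverse a morphism by
`SemiGraph.Hom.isoOfBijective`. [cite: MochizukiSemiAnbd2006, Def 2.2(ii) p.24] -/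
theorem Hom.IsIso.isIso_base {F : Hom 𝒢 ℋ} (h : F.IsIso) :
    CategoryTheory.IsIso (C := SemiGraph.{u}) F.base :=
  let e : 𝒢.graph ≅ ℋ.graph :=
    SemiGraph.Hom.isoOfBijective (F.base : 𝒢.graph ⟶ ℋ.graph) h.bijective_vertexMap h.bijective_edgeMap
      (SemiGraph.Hom.branchMap_bijective_of_edgeMap_bijective _ h.bijective_edgeMap) h.abuts_none
  ⟨⟨e.inv, e.hom_inv_id, e.inv_hom_id⟩⟩

/-- Hence an isomorphism of semi-graphs of anabelioids has an underlying ISOMORPHISM of semi-graphs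
`𝔾 ≅ 𝔾'` whose `hom` is its underlying morphism. [cite: MochizukiSemiAnbd2006, Def 2.2(ii) p.24] -/
theorem Hom.IsIso.exists_graphIso {F : Hom 𝒢 ℋ} (h : F.IsIso) :
    ∃ e : 𝒢.graph ≅ ℋ.graph, e.hom = (F.base : 𝒢.graph ⟶ ℋ.graph) :=
  haveI := h.isIso_base
  ⟨asIso (F.base : 𝒢.graph ⟶ ℋ.graph), asIso_hom _⟩

end ProfiniteSemiGraph

open ProfiniteSemiGraph

/-! ### Equivariance against families of automorphisms of the underlying semi-graphs -/

section AutAction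

variable {Kα : Type u} [Field Kα] {Kβ : Type u} [Field Kβ]
  (pα pβ : ℕ) [Fact pα.Prime] [Fact pβ.Prime]
  [Algebra ℚ_[pα] Kα] [FiniteDimensional ℚ_[pα] Kα] [Algebra ℚ_[pβ] Kβ] [FiniteDimensional ℚ_[pβ] Kβ]
  (Ωα : SpecialFibreOrigin Kα) (Ωβ : SpecialFibreOrigin Kβ)
  {Dα : TemperedArithmeticGroup Kα} {Dβ : TemperedArithmeticGroup Kβ}
  {Sα : SpecialFibreData Dα} {Sβ : SpecialFibreData Dβ}

/-- **Equivariance against automorphism families.**  At certified special fibres, let `F` be the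
`γ`-compatible isomorphism, and let `AX : Γ → Aut 𝔾^c[α]`, `AY : Γ' → Aut 𝔾^c[β]` be families of
automorphisms of the underlying semi-graphs (e.g. the (P2) actions of `Π^temp`, restricted to `Δ^temp`)
such that every `AX g` underlies a self-isomorphism of `𝒢^c[α]` Cor-3.11-compatible with `σ g` and every
`AY g'` one of `𝒢^c[β]` compatible with `τ g'`, and `γ ∘ σ g = τ (t g) ∘ γ` (`t : Γ → Γ'`, e.g. `γ` itself
on `Δ^temp`).  Then `F (AX g · v) = AY (t g) · F v` and `F (AX g · e) = AY (t g) · F e` (F-1721 BY NAME).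
[cite: MochizukiSemiAnbd2006, Cor 3.11 pp.45-46] -/
theorem cor311_base_equivariant_of_autAction (h311 : Cor311 pα pβ Ωα Ωβ)
    (hSα : Ωα.IsSpecialFibreOf Dα Sα) (hSβ : Ωβ.IsSpecialFibreOf Dβ Sβ) {γ : Dα.delta ≃ₜ* Dβ.delta}
    {F : Hom Sα.Gc Sβ.Gc} (hF : F.IsIso) (hFc : Cor311Compatible Sα Sβ γ F)
    {Γ : Type*} {Γ' : Type*} (t : Γ → Γ') (σ : Γ → (Dα.delta ≃ₜ* Dα.delta))
    (τ : Γ' → (Dβ.delta ≃ₜ* Dβ.delta)) (hστ : ∀ g x, γ (σ g x) = τ (t g) (γ x))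
    (AX : Γ → Aut Sα.Gc.graph) (AY : Γ' → Aut Sβ.Gc.graph)
    (hAX : ∀ g, ∃ A : Hom Sα.Gc Sα.Gc, A.IsIso ∧ Cor311Compatible Sα Sα (σ g) A ∧
      (A.base : Sα.Gc.graph ⟶ Sα.Gc.graph) = (AX g).hom)
    (hAY : ∀ g', ∃ B : Hom Sβ.Gc Sβ.Gc, B.IsIso ∧ Cor311Compatible Sβ Sβ (τ g') B ∧
      (B.base : Sβ.Gc.graph ⟶ Sβ.Gc.graph) = (AY g').hom) :
    (∀ g v, F.base.vertexMap ((AX g).hom.vertexMap v) = (AY (t g)).hom.vertexMap (F.base.vertexMap v)) ∧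
      ∀ g e, F.base.edgeMap ((AX g).hom.edgeMap e) = (AY (t g)).hom.edgeMap (F.base.edgeMap e) := by
  have key : ∀ g,
      F.base.vertexMap ∘ (AX g).hom.vertexMap = (AY (t g)).hom.vertexMap ∘ F.base.vertexMap ∧
        F.base.edgeMap ∘ (AX g).hom.edgeMap = (AY (t g)).hom.edgeMap ∘ F.base.edgeMap := by
    intro g
    obtain ⟨A, hA, hAc, hAb⟩ := hAX g
    obtain ⟨B, hB, hBc, hBb⟩ := hAY (t g)
    rw [← hAb, ← hBb]
    exact cor311_base_equivariant pα pβ Ωα Ωβ h311 hSα hSβ (hστ g) hF hFc hA hAc hB hBc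
  exact ⟨fun g v => congrFun (key g).1 v, fun g e => congrFun (key g).2 e⟩

/-- ★ **Cor. 3.11 reconstructs `FI : 𝔾^c[α] ≅ 𝔾^c[β]`, equivariant for automorphism actions** — the
shape of clause (3) of the Thm. 6.5 (iii) binder `hLG` («`F_i (g · e) = γ(g) · F_i e`»): at certified
special fibres and for every `γ : Δ[α] ⥲ Δ[β]`, F-1721 (BY NAME) yields an isomorphism of the underlying
semi-graphs underlying a `γ`-compatible isomorphism of semi-graphs of anabelioids, which for all families
`AX`, `AY` of automorphisms underlying compatible self-isomorphisms over `σ g`, `τ g'` intertwined by `γ`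
along `t` satisfies `FI (AX g · e) = AY (t g) · FI e` on edges and on vertices.
[cite: MochizukiSemiAnbd2006, Cor 3.11 pp.45-46] -/
theorem cor311_exists_graphIso_equivariant (h311 : Cor311 pα pβ Ωα Ωβ)
    (hSα : Ωα.IsSpecialFibreOf Dα Sα) (hSβ : Ωβ.IsSpecialFibreOf Dβ Sβ) (γ : Dα.delta ≃ₜ* Dβ.delta)
    {Γ : Type*} {Γ' : Type*} (t : Γ → Γ') (σ : Γ → (Dα.delta ≃ₜ* Dα.delta))
    (τ : Γ' → (Dβ.delta ≃ₜ* Dβ.delta)) (hστ : ∀ g x, γ (σ g x) = τ (t g) (γ x))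
    (AX : Γ → Aut Sα.Gc.graph) (AY : Γ' → Aut Sβ.Gc.graph)
    (hAX : ∀ g, ∃ A : Hom Sα.Gc Sα.Gc, A.IsIso ∧ Cor311Compatible Sα Sα (σ g) A ∧
      (A.base : Sα.Gc.graph ⟶ Sα.Gc.graph) = (AX g).hom)
    (hAY : ∀ g', ∃ B : Hom Sβ.Gc Sβ.Gc, B.IsIso ∧ Cor311Compatible Sβ Sβ (τ g') B ∧
      (B.base : Sβ.Gc.graph ⟶ Sβ.Gc.graph) = (AY g').hom) :
    ∃ FI : Sα.Gc.graph ≅ Sβ.Gc.graph,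
      (∃ F : Hom Sα.Gc Sβ.Gc, F.IsIso ∧ Cor311Compatible Sα Sβ γ F ∧
        FI.hom = (F.base : Sα.Gc.graph ⟶ Sβ.Gc.graph)) ∧
      (∀ g v, FI.hom.vertexMap ((AX g).hom.vertexMap v) = (AY (t g)).hom.vertexMap (FI.hom.vertexMap v)) ∧
      ∀ g e, FI.hom.edgeMap ((AX g).hom.edgeMap e) = (AY (t g)).hom.edgeMap (FI.hom.edgeMap e) := by
  obtain ⟨⟨F, hF, hFc, -⟩, -⟩ := h311 Dα Dβ Sα Sβ hSα hSβ γ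
  haveI := hF.isIso_base
  obtain ⟨hv, he⟩ := cor311_base_equivariant_of_autAction pα pβ Ωα Ωβ h311 hSα hSβ hF hFc t σ τ hστ
    AX AY hAX hAY
  exact ⟨asIso (F.base : Sα.Gc.graph ⟶ Sβ.Gc.graph), ⟨F, hF, hFc, asIso_hom _⟩, hv, he⟩

end AutAction

end Literature.AnabelianGeometry.SemiGraphs

end
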